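import Summits.ValiantsHypothesis.ValiantsHypothesis.Theorems.SliceSignRankSrkNotQPForsterSliceBalanced
import Literature.Barriers.MatrixMultiplication.UnstableTensorBarrierVertex

/-!
# Route SliceSignRank — crux `SrkNotQP` (stmt-ValiantsHypothesis-20857), line `forster_slice`:
# the factorial-power bound for representations of bounded Hadamard weight (threshold-weight form)

Second typed surrogate of the registered stub `stub_forsterSlice` (⟺ `srk(n) ≥ (n!)^{1/C}`, see
`SliceSignRankSrkNotQPForsterSliceEquiv`). The discrepancy half of Forster's argument works on the
slice with no loss: if `F(σ) = Σ_t Π_i W_t(σ i, i)` sign-represents `sgn` on `S_n` with MARGIN `1`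
(`|F(σ)| ≥ 1`, e.g. any integer-valued representation), then the total Hadamard weight of the twists
dominates `n!`:

  `n! ≤ Σ_t √(Π_i Σ_a W_t(a,i)²)`   (`factorial_le_sum_hadamardWeight`),

because `Σ_σ |F(σ)| = Σ_t det W_t` (landed dictionary `sum_abs_eq_sum_det`) and
`|det W| ≤ √(Π_i Σ_a W(a,i)²)` (Hadamard, tree `det_sq_le_prod_sum_sq_fin`). Consequently
(`factorial_le_card_mul_of_weight_le`) a margin-1 representation whose twists have Hadamard weight
`≤ M` has `k ≥ n!/M`; for `±1` twists (`M = n^{n/2}`, `factorial_le_card_mul_pow_of_pmOne`)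
`k ≥ n!/n^{n/2} = 2^{Ω(n log n)}` — the stub's conclusion (in the form `n! ≤ k^C`, large `n`) holds for
every representation by unit twists with `±1` (or bounded integer) coefficients.

HONEST CALIBRATION. This is the threshold-WEIGHT lower bound, not a LENGTH lower bound: a short
representation of `sgn` (if any) must have weights astronomically larger than its margin (dynamic
range `≥ n!/(k·n^{n/2})`), i.e. live entirely on cancellation. Together with the balanced case
(`forsterSlice_of_balanced`) it brackets what a counterexample to the stub must look like; it does
not prove the stub. The stub and the crux remain OPEN; `VP ≠ VNP` is untouched. Landed
`--supports stmt-ValiantsHypothesis-20857` (helper).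
-/

-- Sub = Summit layout duplicates the namespace component
set_option linter.dupNamespace false

namespace Summit.ValiantsHypothesis.ValiantsHypothesis.Theorems.SliceSignRank.SrkNotQP

open Finset Equiv

/-- **Hadamard's bound for a twist, column form**: `det W ≤ √(Π_i Σ_a W(a,i)²)`.
[folklore; Hadamard's inequality, tree `det_sq_le_prod_sum_sq_fin`] -/
theorem det_le_sqrt_hadamardWeight {n : ℕ} (W : Matrix (Fin n) (Fin n) ℝ) :
    W.det ≤ Real.sqrt (∏ i, ∑ a, W a i ^ 2) := by
  have h := Literature.Barriers.MatrixMultiplication.det_sq_le_prod_sum_sq_fin W.transpose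
  rw [Matrix.det_transpose] at h
  simp only [Matrix.transpose_apply] at h
  calc W.det ≤ |W.det| := le_abs_self _
    _ = Real.sqrt (W.det ^ 2) := (Real.sqrt_sq_eq_abs _).symm
    _ ≤ Real.sqrt (∏ i, ∑ a, W a i ^ 2) := Real.sqrt_le_sqrt h

/-- **Margin-one representations have total Hadamard weight at least `n!`.** If
`F(σ) = Σ_t Π_i W_t(σ i, i)` sign-represents `sgn` on `S_n` and `|F(σ)| ≥ 1` for all `σ`, then
`n! ≤ Σ_t √(Π_i Σ_a W_t(a,i)²)`. (Discrepancy half of Forster: `n! ≤ Σ_σ |F σ| = Σ_t det W_t`,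
then Hadamard.) [this file] -/
theorem factorial_le_sum_hadamardWeight {n k : ℕ} (W : Fin k → Matrix (Fin n) (Fin n) ℝ)
    (hrep : ∀ σ : Perm (Fin n), 0 < ((Perm.sign σ : ℤ) : ℝ) * ∑ t, ∏ i, W t (σ i) i)
    (hmargin : ∀ σ : Perm (Fin n), 1 ≤ |∑ t, ∏ i, W t (σ i) i|) :
    (n.factorial : ℝ) ≤ ∑ t, Real.sqrt (∏ i, ∑ a, W t a i ^ 2) := by
  have hcard : (Finset.univ : Finset (Perm (Fin n))).card = n.factorial := by
    rw [Finset.card_univ, Fintype.card_perm, Fintype.card_fin]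
  calc (n.factorial : ℝ) = ∑ _σ : Perm (Fin n), (1 : ℝ) := by
        rw [Finset.sum_const, hcard, nsmul_eq_mul, mul_one]
    _ ≤ ∑ σ : Perm (Fin n), |∑ t, ∏ i, W t (σ i) i| := Finset.sum_le_sum fun σ _ => hmargin σ
    _ = ∑ t, (W t).det := sum_abs_eq_sum_det W hrep
    _ ≤ ∑ t, Real.sqrt (∏ i, ∑ a, W t a i ^ 2) :=
        Finset.sum_le_sum fun t _ => det_le_sqrt_hadamardWeight (W t)

/-- **Length ≥ n! / weight.** A margin-one sign-representation of `sgn` on `S_n` by `k` twists of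
Hadamard weight `√(Π_i Σ_a W_t(a,i)²) ≤ M` each has `n! ≤ k · M`. [this file] -/
theorem factorial_le_card_mul_of_weight_le {n k : ℕ} (W : Fin k → Matrix (Fin n) (Fin n) ℝ) (M : ℝ)
    (hrep : ∀ σ : Perm (Fin n), 0 < ((Perm.sign σ : ℤ) : ℝ) * ∑ t, ∏ i, W t (σ i) i)
    (hmargin : ∀ σ : Perm (Fin n), 1 ≤ |∑ t, ∏ i, W t (σ i) i|)
    (hM : ∀ t, Real.sqrt (∏ i, ∑ a, W t a i ^ 2) ≤ M) :
    (n.factorial : ℝ) ≤ (k : ℝ) * M :=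
  calc (n.factorial : ℝ) ≤ ∑ t, Real.sqrt (∏ i, ∑ a, W t a i ^ 2) :=
        factorial_le_sum_hadamardWeight W hrep hmargin
    _ ≤ ∑ _t : Fin k, M := Finset.sum_le_sum fun t _ => hM t
    _ = (k : ℝ) * M := by rw [Finset.sum_const, Finset.card_univ, Fintype.card_fin, nsmul_eq_mul]

/-- **Unit twists need `k ≥ n!/n^{n/2}` terms.** If `k` twists with entries in `{1, −1}` (integer
matrices `S_t`, read in `ℝ`) sign-represent `sgn` on `S_n`, then `n! ≤ k · √(nⁿ)`: the
representing function is a nonzero integer at every `σ` (margin `1`) and each twist has Hadamard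
weight `√(nⁿ)`. In particular such representations satisfy the conclusion of `stub_forsterSlice`
(`srk ≥ (n!)^{Ω(1)}`); a short representation of `sgn`, if it exists, must use unbounded weights.
[this file] -/
theorem factorial_le_card_mul_pow_of_pmOne {n k : ℕ} (S : Fin k → Matrix (Fin n) (Fin n) ℤ)
    (hpm : ∀ t a i, S t a i = 1 ∨ S t a i = -1)
    (hrep : ∀ σ : Perm (Fin n),
      0 < ((Perm.sign σ : ℤ) : ℝ) * ∑ t, ∏ i, ((S t (σ i) i : ℤ) : ℝ)) :
    (n.factorial : ℝ) ≤ (k : ℝ) * Real.sqrt ((n : ℝ) ^ n) := by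
  -- the real twists
  set W : Fin k → Matrix (Fin n) (Fin n) ℝ := fun t => Matrix.of fun a i => ((S t a i : ℤ) : ℝ)
    with hW
  have hWapp : ∀ t a i, W t a i = ((S t a i : ℤ) : ℝ) := fun t a i => rfl
  have hrepW : ∀ σ : Perm (Fin n), 0 < ((Perm.sign σ : ℤ) : ℝ) * ∑ t, ∏ i, W t (σ i) i := by
    intro σ; simpa only [hWapp] using hrep σ
  -- margin one: the value is a nonzero integer
  have hmargin : ∀ σ : Perm (Fin n), 1 ≤ |∑ t, ∏ i, W t (σ i) i| := by
    intro σ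
    have hz : (∑ t, ∏ i, W t (σ i) i) = ((∑ t, ∏ i, S t (σ i) i : ℤ) : ℝ) := by
      push_cast; simp only [hWapp]
    have hpos := hrepW σ
    rw [hz] at hpos ⊢
    have hne : (∑ t, ∏ i, S t (σ i) i : ℤ) ≠ 0 := by
      intro h0; rw [h0] at hpos; simp at hpos
    have h1 : (1 : ℤ) ≤ |∑ t, ∏ i, S t (σ i) i| := Int.one_le_abs hne
    exact_mod_cast h1
  -- weight of a ±1 twist
  have hM : ∀ t, Real.sqrt (∏ i, ∑ a, W t a i ^ 2) ≤ Real.sqrt ((n : ℝ) ^ n) := by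
    intro t
    apply Real.sqrt_le_sqrt
    have hsq : ∀ a i, W t a i ^ 2 = 1 := by
      intro a i
      rcases hpm t a i with h | h <;> simp [hWapp, h]
    simp only [hsq, Finset.sum_const, Finset.card_univ, Fintype.card_fin, nsmul_eq_mul, mul_one,
      Finset.prod_const]
    exact le_refl _
  exact factorial_le_card_mul_of_weight_le W _ hrepW hmargin hM

end Summit.ValiantsHypothesis.ValiantsHypothesis.Theorems.SliceSignRank.SrkNotQP
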